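import Literature.MathematicalPhysics.QuantumFieldTheory.Balaban1983to89.B9Eq372RemLetters

/-!
# `Balaban1983to89.B9Eq376POneLetters` — [Balaban1985BackgroundPropagators] (3.76) p. 405: the letters of `P₁(A)` BETWEEN the site and the
# bond carrier — `D_U`, `D*_U` (true units), the first-order differences `D_{U′U} − D_U` (3.70), `D*_{U′U} − D*_U` (3.74) with their sizes
# `O(1)α₁(Lʲη)⁻¹e^{−δd}` («O(|A|)», (3.37)), real coordinates for TWO-space letters, and the identity (3.76) `D′R′D′* = DRD* − V₂(A) − P₁(A)`
# on the bond carrier with `P₁(A)` CONCRETE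

statement-level skeleton of published theorems with citation tags; proofs where landed; nothing here is a claim about the Yang–Mills mass gap

CITATION HEADER (lean-in-tree rule).  B9 = T. Bałaban, *Propagators for lattice gauge theories in a background field*, Commun. Math. Phys.
**99** (1985) 389–434 [Balaban1985BackgroundPropagators] (held `paper:balaban1985-cmp99-background-propagators`; journal page = PDF page + 388).
Rows B9.Eq3.76 (the word `P₁(A)`), B9.Eq3.70 / B9.Eq3.74 (the expansions `D_{U′U} = D_U + …`, `D*_{U′U} = D*_U + …`), B9.Eq3.75
(`D′D′* = DD* − V₂(A)`), B9.Eq3.42 p. 397 (entries of operators from site functions to bond functions).  [4] = [Balaban1984PropagatorsII]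
(2.51)–(2.55) p. 232 (block majorants, «this property is preserved under the composition of operators possessing it»).  Cell
`lit-balaban`, seat r06 (B9 fold owner) gen 11, FILE 10 of the G-side programme (files 1–8: `B9Eq371GradLetters` … `B9Ineq386V3Concrete`;
FILE 9 `B6RandomWalkBlocks`).

THE PRINT (p. 405, OCR of the held scan, checked against the page image): «Next we consider the operator DRD\*. We have discussed already
the expansion (3.68) of the operator P(U′U), so we have to consider the differential operators again. We have [(3.74)] … [(3.75)] where
the operators F_{2,k}(A), V₂(A) satisfy the bounds (3.72), (3.73). These expansions imply the following one:
D_{U′U}R(U′U)D\*_{U′U} = D_UR(U)D\*_U − V₂(A) − (D_{U′U} − D_U)P(U)D\*_U − D_UP(U)(D\*_{U′U} − D\*_U) − (D_{U′U} − D_U)P(U)(D\*_{U′U} − D\*_U)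
− D_{U′U}F(A)D\*_{U′U} = DRD\* − V₂(A) − P₁(A),  (3.76)» (here `R(U) = I − P(U)`, `P(U′U) = P(U) + F(A)` by (3.68); the cell's ring-level
reading is `B9Eq386Neumann.pOne` / `eq376`).

WHAT THIS FILE PROVES (0 sorry; definitions with bodies + theorems).
* §1 `hasMajorantHom_of_local` — the two-space twin of `B9Ineq386CommSum.hasMajorant_of_local`: a stencil-local letter FROM the functions on
  `X` TO the functions on `Y` has the two-space block majorant `c(y)e^{δd₀}e^{−δd(y,y′)}` ([4] (2.51) read for (3.42)₂,₄-type operators).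
* §2 `conjHom b L` — real coordinates (`B9Eq352DivFormLetters.coordEquiv`) for an `ℝ`-linear letter `L : (X → E) → (Y → E)` between two
  lattice-function spaces; `conjHom_apply`, `conjHom_comp` (functorial), `conjHom_eq_conj` (for `X = Y` it IS gen 8's `conj b`), `conjHom_add`,
  `conjHom_sub`; THE SEAM `hasMajorantHom_conj_of_local` (two-space twin of `B9Eq352DivFormLetters.hasMajorant_conj_of_local`).
* §3 the letters: `gradLin T c V : (S → 𝔸) →ₗ[ℝ] (κ × S → 𝔸)`, `f ↦ ((μ,x) ↦ c·(D¹_{V,μ}f)(x))` (true units `c = η⁻¹`; (3.3)) and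
  `divLin T c V : (κ × S → 𝔸) →ₗ[ℝ] (S → 𝔸)`, `F ↦ (x ↦ c·Σ_ν(D¹*_{V,ν}F_ν)(x))` ((3.8)); `gradLin_comp_divLin`: `gradLin ∘ divLin =
  B9Eq372RemLetters.gradDivLetter T c V` (pv27's `DD*`, so that (3.75) `conj_gradDivLetter_prodCfg` applies); `conjHom_gradLin_comp_divLin`.
* §4 the sizes: `norm_gradLin_sub_apply_le` / `norm_divLin_sub_apply_le` — pointwise `‖((D_{U′U} − D_U)f)_μ(x)‖ ≦ 4‖A_μ(x)‖·‖f(x+e_μ)‖` and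
  `‖((D*_{U′U} − D*_U)F)(x)‖ ≦ 4·Σ_ν‖(τ*_νA_ν)(x)‖·‖F_ν(x−e_ν)‖` for a group-valued background and `2η‖A‖ ≦ 1` (from pv27's exact (3.70)/(3.74)
  `B9Eq370Expansion.norm_covD_prodCfg_sub_le` / `norm_covDstar_prodCfg_sub_le` and `|e^t − 1| ≦ 2|t|`, `|t| ≦ 1`); the two-space majorants
  `hasMajorantHom_gradLin_sub` (`E := conjHom b (gradLin(U′U) − gradLin U) ≺ 4α₁(Lʲη)⁻¹·M·e^{δd₀}·e^{−δd}`, `M = M₂Σ_i‖b_i‖`) and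
  `hasMajorantHom_divLin_sub` (`E* ≺ 4·card κ·α₁(Lʲη)⁻¹·M·e^{δd₀}·e^{−δd}`) under (3.37) `‖A‖, ‖τ*A‖ ≦ α₁(Lʲη)⁻¹` blockwise and `ηα₁(Lʲη)⁻¹ ≦ 1/4`.
* §5 (3.76) CONCRETE on the bond carrier: with `Dc := conjHom b (gradLin T η⁻¹ U)`, `Dc′ := conjHom b (gradLin T η⁻¹ (U′U))`, `Dsc`, `Dsc′` likewise,
  `conjHom_gradLin_prodCfg_comp_divLin_prodCfg` ((3.75) in coordinates: `Dc′ ∘ Dsc′ = Dc ∘ Dsc − conj b (V₂Op η A)`) and `eq376_concrete`: for ANY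
  site-carrier letters `P`, `P′`, `Dc′∘(1 − (P + P′))∘Dsc′ = Dc∘(1 − P)∘Dsc − conj b (V₂Op η A) − P₁` with
  `P₁ = (Dc′ − Dc)∘P∘Dsc + Dc∘P∘(Dsc′ − Dsc) + (Dc′ − Dc)∘P∘(Dsc′ − Dsc) + Dc′∘P′∘Dsc′` — the `h376` hypothesis of
  `B9Ineq386V3Concrete.thm34_G_entries13_concreteV₃` as a theorem, `P₁` concrete.

HONEST SCOPE / NOT CLAIMED.  (3.77) (the SIZE of `P₁(A)`) is NOT proved here (FILE 11, via `B9Ineq377POne.ineq377_op` and `B6RandomWalkBlocks`);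
the projection `P(U)` and `F(A) = P′(A)` of (3.68) stay abstract letters of the site carrier; no kernel↔block identification; NOT summit progress.

RELATED IN THE TREE, NOT DUPLICATED (searched 2026-08-21: `lean search 'conjHom|gradLin|divLin|hasMajorantHom_of_local|eq376_concrete'` — only
`B9Eq395Hom` (a different `Hom`: the (3.95) homotopy) and `B9Eq386Neumann.eq376` (ring level, BY NAME below); pv27's `covD`/`covDstar`/`divB`/`gradDiv`,
`B9Eq370Expansion.norm_covD_prodCfg_sub_le`/`norm_covDstar_prodCfg_sub_le`, `B9Eq372RemLetters.gradDivLetter`/`conj_gradDivLetter_prodCfg`,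
`B6RandomWalkHom.HasMajorantHom` are used BY NAME).
-/

noncomputable section

namespace Literature.MathematicalPhysics.QuantumFieldTheory.Balaban1983to89.B9Eq376POneLetters

open NormedSpace Complex
open Literature.MathematicalPhysics.QuantumFieldTheory.Balaban1983to89
open Literature.MathematicalPhysics.QuantumFieldTheory.Balaban1983to89.B6RandomWalk (HasMajorant BlockSupp hasMajorant_mono)
open Literature.MathematicalPhysics.QuantumFieldTheory.Balaban1983to89.B6RandomWalkHom (HasMajorantHom hasMajorantHom_mono)
open Literature.MathematicalPhysics.QuantumFieldTheory.Balaban1983to89.B9Thm34Ext (toB6)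
open Literature.MathematicalPhysics.QuantumFieldTheory.Balaban1983to89.B9Eq39Adjoint
open Literature.MathematicalPhysics.QuantumFieldTheory.Balaban1983to89.B9Eq352DivForm (tauF tauB tauB_apply)
open Literature.MathematicalPhysics.QuantumFieldTheory.Balaban1983to89.B9Eq352DivFormLetters
open Literature.MathematicalPhysics.QuantumFieldTheory.Balaban1983to89.B9Eq372RemLetters
open Literature.MathematicalPhysics.QuantumFieldTheory.Balaban1983to89.B9Eq370Expansion (norm_covD_prodCfg_sub_le norm_covDstar_prodCfg_sub_le)
open Literature.MathematicalPhysics.QuantumFieldTheory.Balaban1983to89.B9Eq375Composition (gradDiv covD_sum)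

/-! ## §1  Two-space local letters have two-space block majorants -/

section Local

variable {g : B9.Geometry} [Fintype g.Site] {R : ℝ} {H : Prop} {X Y : Type}

/-- **Dictionary, two spaces**: a letter `L` from the functions on `X` to the functions on `Y` controlled by a stencil — `|μ(x′)| ≦ B` at the
stencil points `x′ ∈ X` of `v ∈ Y` implies `|(Lμ)(v)| ≦ c(y)B`, `y` the block of `v`, `c ≧ 0`, every stencil point in a block at `d`-distance
`≦ d₀` from `y` — has, for every `δ ≧ 0`, the two-space majorant `c(y)e^{δd₀}e^{−δd(y,y′)}` (the shape (3.42)₂ / [4] (2.51) for operators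
between two function spaces; twin of `B9Ineq386CommSum.hasMajorant_of_local`).
[cite: Balaban1985BackgroundPropagators, (3.42) p.397 + (3.37) p.396; Balaban1984PropagatorsII, (2.51) p.232] -/
theorem hasMajorantHom_of_local (blkX : X → g.Site) (blkY : Y → g.Site) (near : Y → X → Prop) (c : g.Site → ℝ) (d₀ δ : ℝ)
    (hc : ∀ a, 0 ≤ c a) (hδ : 0 ≤ δ) (hnear : ∀ v x', near v x' → g.dist (blkY v) (blkX x') ≤ d₀)
    {L : (X → ℝ) →ₗ[ℝ] (Y → ℝ)}
    (hL : ∀ (μ : X → ℝ) (v : Y) (B : ℝ), (∀ x', near v x' → |μ x'| ≤ B) → |L μ v| ≤ c (blkY v) * B) :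
    HasMajorantHom (g := toB6 g R H) blkX blkY L
      (fun a b => c a * Real.exp (δ * d₀) * Real.exp (-(δ * g.dist a b))) := by
  intro y' μ B hμ v
  by_cases hv : ∃ x', near v x' ∧ blkX x' = y'
  · obtain ⟨x', hvx', hx'y⟩ := hv
    have hB : ∀ x'', near v x'' → |μ x''| ≤ B := fun x'' _ => by
      by_cases hb : blkX x'' = y'
      · exact hμ.bound x'' hb
      · rw [hμ.off x'' hb, abs_zero]; exact hμ.nonneg
    have h1 : |L μ v| ≤ c (blkY v) * B := hL μ v B hB
    have hd : g.dist (blkY v) y' ≤ d₀ := by rw [← hx'y]; exact hnear v x' hvx'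
    have he : 1 ≤ Real.exp (δ * d₀) * Real.exp (-(δ * g.dist (blkY v) y')) := by
      rw [← Real.exp_add]
      exact Real.one_le_exp (by nlinarith)
    calc |L μ v| ≤ c (blkY v) * 1 * B := by simpa using h1
      _ ≤ c (blkY v) * (Real.exp (δ * d₀) * Real.exp (-(δ * g.dist (blkY v) y'))) * B := by
          have hcB : 0 ≤ c (blkY v) * B := mul_nonneg (hc _) hμ.nonneg
          nlinarith
      _ = c (blkY v) * Real.exp (δ * d₀) * Real.exp (-(δ * g.dist (blkY v) y')) * B := by ring
  · have hv' : ∀ x'', near v x'' → blkX x'' ≠ y' := fun x'' hn hb => hv ⟨x'', hn, hb⟩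
    have hB : ∀ x'', near v x'' → |μ x''| ≤ 0 := fun x'' hn => by rw [hμ.off x'' (hv' x'' hn), abs_zero]
    have h1 : |L μ v| ≤ c (blkY v) * 0 := hL μ v 0 hB
    have h0 : 0 ≤ c (blkY v) * Real.exp (δ * d₀) * Real.exp (-(δ * g.dist (blkY v) y')) * B :=
      mul_nonneg (mul_nonneg (mul_nonneg (hc _) (Real.exp_nonneg _)) (Real.exp_nonneg _)) hμ.nonneg
    calc |L μ v| ≤ c (blkY v) * 0 := h1
      _ = 0 := mul_zero _
      _ ≤ _ := h0

end Local

/-! ## §2  Real coordinates for letters between two lattice-function spaces -/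

section Coordinates

variable {E : Type*} [NormedAddCommGroup E] [NormedSpace ℝ E] {ι : Type} [Fintype ι] {X Y Z : Type}
variable (b : Module.Basis ι ℝ E)

/-- **Real coordinates of a two-space letter**: `conjHom b L = coord_Y ∘ L ∘ coord_X⁻¹` for an `ℝ`-linear `L : (X → E) → (Y → E)` (the (2.51)
reading of a (3.42)₂,₄-type operator between two function spaces; for `X = Y` it is `B9Eq352DivFormLetters.conj b`, `conjHom_eq_conj`).
[folklore] [cite: Balaban1984PropagatorsII, (2.51) p.232; Balaban1985BackgroundPropagators, (3.42) p.397] -/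
def conjHom (L : (X → E) →ₗ[ℝ] (Y → E)) : (X × ι → ℝ) →ₗ[ℝ] (Y × ι → ℝ) :=
  (coordEquiv b).toLinearMap ∘ₗ (L ∘ₗ (coordEquiv b).symm.toLinearMap)

/-- Unfolding `conjHom`: `(conjHom b L μ)(v,i) = b.repr ((L (coord⁻¹μ))(v)) i`. [folklore] [cite: Balaban1984PropagatorsII, (2.51) p.232] -/
theorem conjHom_apply (L : (X → E) →ₗ[ℝ] (Y → E)) (μ : X × ι → ℝ) (p : Y × ι) :
    conjHom b L μ p = b.repr (L ((coordEquiv b).symm μ) p.1) p.2 :=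
  rfl

/-- `conjHom` is functorial: `conjHom b L₁ ∘ conjHom b L₂ = conjHom b (L₁ ∘ L₂)` («this property is preserved under the composition of
operators», [4] p. 232). [folklore] [cite: Balaban1984PropagatorsII, (2.52)–(2.55) p.232] -/
theorem conjHom_comp (L₁ : (Y → E) →ₗ[ℝ] (Z → E)) (L₂ : (X → E) →ₗ[ℝ] (Y → E)) :
    conjHom b L₁ ∘ₗ conjHom b L₂ = conjHom b (L₁ ∘ₗ L₂) := by
  apply LinearMap.ext
  intro μ
  simp only [conjHom, LinearMap.comp_apply, LinearEquiv.coe_coe, LinearEquiv.symm_apply_apply]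

/-- For ONE space `conjHom b T` is gen 8's `conj b T`. [folklore] [cite: Balaban1984PropagatorsII, (2.51) p.232] -/
theorem conjHom_eq_conj (T : Module.End ℝ (X → E)) : conjHom b T = conj b T := by
  apply LinearMap.ext
  intro μ
  funext p
  rw [conjHom_apply, conj_apply]

/-- `conjHom` is additive («A summation preserves it also», [4] p. 232). [folklore] [cite: Balaban1984PropagatorsII, (2.52) p.232] -/
theorem conjHom_add (L₁ L₂ : (X → E) →ₗ[ℝ] (Y → E)) : conjHom b (L₁ + L₂) = conjHom b L₁ + conjHom b L₂ := by
  simp only [conjHom, LinearMap.add_comp, LinearMap.comp_add]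

/-- `conjHom` respects differences. [folklore] [cite: Balaban1984PropagatorsII, (2.52) p.232] -/
theorem conjHom_sub (L₁ L₂ : (X → E) →ₗ[ℝ] (Y → E)) : conjHom b (L₁ - L₂) = conjHom b L₁ - conjHom b L₂ := by
  simp only [conjHom, LinearMap.sub_comp, LinearMap.comp_sub]

variable {g : B9.Geometry} [Fintype g.Site] {Rr : ℝ} {H : Prop}

/-- **THE SEAM, TWO SPACES**: a stencil-local letter `L : (X → E) → (Y → E)` — `‖(Lf)(v)‖ ≦ c(y)B` whenever `‖f(x′)‖ ≦ B` at the stencil points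
`x′` of `v`, `y` the block of `v`, `c ≧ 0`, stencil in blocks at `d`-distance `≦ d₀` from `y` — with `|b.repr w i| ≦ M₂‖w‖` has, after real
coordinates, the two-space majorant `conjHom b L ≺ c(y)·M₂(Σ_i‖b_i‖)·e^{δd₀}·e^{−δd(y,y′)}` for every `δ ≧ 0` (twin of
`B9Eq352DivFormLetters.hasMajorant_conj_of_local`; proof: §1 on the carriers `X × ι`, `Y × ι` and the two norm comparisons of gen 8).
[cite: Balaban1984PropagatorsII, (2.51) p.232; Balaban1985BackgroundPropagators, (3.42) p.397 + (3.37) p.396] -/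
theorem hasMajorantHom_conj_of_local (blkX : X → g.Site) (blkY : Y → g.Site) (near : Y → X → Prop) (c : g.Site → ℝ) (d₀ δ M₂ : ℝ)
    (hc : ∀ a, 0 ≤ c a) (hδ : 0 ≤ δ) (hM₂ : 0 ≤ M₂) (hrepr : ∀ (w : E) (i : ι), |b.repr w i| ≤ M₂ * ‖w‖)
    (hnear : ∀ v x', near v x' → g.dist (blkY v) (blkX x') ≤ d₀)
    (L : (X → E) →ₗ[ℝ] (Y → E))
    (hL : ∀ (f : X → E) (v : Y) (B : ℝ), (∀ x', near v x' → ‖f x'‖ ≤ B) → ‖L f v‖ ≤ c (blkY v) * B) :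
    HasMajorantHom (g := toB6 g Rr H) (fun p : X × ι => blkX p.1) (fun q : Y × ι => blkY q.1) (conjHom b L)
      (fun a a' => c a * (M₂ * ∑ i, ‖b i‖) * Real.exp (δ * d₀) * Real.exp (-(δ * g.dist a a'))) := by
  have hSb : 0 ≤ ∑ i, ‖b i‖ := Finset.sum_nonneg fun i _ => norm_nonneg _
  refine hasMajorantHom_of_local (R := Rr) (H := H) (fun p : X × ι => blkX p.1) (fun q : Y × ι => blkY q.1)
    (fun q p => near q.1 p.1) (fun a => c a * (M₂ * ∑ i, ‖b i‖)) d₀ δ (fun a => mul_nonneg (hc a) (mul_nonneg hM₂ hSb)) hδ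
    (fun q p hqp => hnear q.1 p.1 hqp) ?_
  intro μ q B hB
  have hf : ∀ x', near q.1 x' → ‖(coordEquiv b).symm μ x'‖ ≤ (∑ i, ‖b i‖) * B := fun x' hx' =>
    norm_coordSymm_apply_le b μ x' B fun i => hB (x', i) hx'
  have h1 : ‖L ((coordEquiv b).symm μ) q.1‖ ≤ c (blkY q.1) * ((∑ i, ‖b i‖) * B) := hL _ q.1 _ hf
  rw [conjHom_apply]
  calc |b.repr (L ((coordEquiv b).symm μ) q.1) q.2|
      ≤ M₂ * ‖L ((coordEquiv b).symm μ) q.1‖ := hrepr _ _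
    _ ≤ M₂ * (c (blkY q.1) * ((∑ i, ‖b i‖) * B)) := mul_le_mul_of_nonneg_left h1 hM₂
    _ = c (blkY q.1) * (M₂ * ∑ i, ‖b i‖) * B := by ring

end Coordinates

/-! ## §3  The letters `D` (sites → bonds) and `D*` (bonds → sites) in true units, for any configuration in the slot of `U` -/

section Letters

variable {𝔸 : Type*} [NormedRing 𝔸] [NormedAlgebra ℂ 𝔸] {S : Type} {κ : Type}
variable (T : κ → Equiv.Perm S)

/-- **`D_V` AS A TWO-SPACE LETTER** (sites → bonds), true units: `(gradLin c V f)(μ,x) = c·(D¹_{V,μ}f)(x) = c·(R(V(x,x+e_μ))f(x+e_μ) − f(x))`,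
`c = η⁻¹` ((3.3); for `V = U` it is `D_U`, for `V = U′U` it is `D_{U′U}` of (3.70)/(3.76)). [cite: Balaban1985BackgroundPropagators, (3.3) p.391 + (3.76) p.405] -/
def gradLin (c : ℂ) (V : κ → S → 𝔸ˣ) : (S → 𝔸) →ₗ[ℝ] (κ × S → 𝔸) where
  toFun f := fun p => c • covD T V p.1 f p.2
  map_add' f f' := by
    funext p
    simp only [Pi.add_apply, covD_add, smul_add]
  map_smul' r f := by
    funext p
    have h : r • f = ((r : ℂ) • f) := by funext z; exact (Complex.coe_smul r (f z)).symm
    simp only [RingHom.id_apply, Pi.smul_apply]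
    rw [h, covD_smul, smul_comm, Complex.coe_smul]

/-- Unfolding `gradLin`. [cite: Balaban1985BackgroundPropagators, (3.3) p.391] -/
theorem gradLin_apply (c : ℂ) (V : κ → S → 𝔸ˣ) (f : S → 𝔸) (p : κ × S) : gradLin T c V f p = c • covD T V p.1 f p.2 := rfl

variable [Fintype κ]

omit [NormedAlgebra ℂ 𝔸] in
/-- `Σ_ν D¹*_ν` is additive in the bond function (pv27's `covDstar_add`, summed). [folklore] [cite: Balaban1985BackgroundPropagators, (3.8) p.392] -/
private theorem sum_covDstar_add (V : κ → S → 𝔸ˣ) (F F' : κ × S → 𝔸) (x : S) :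
    ∑ ν, covDstar T V ν (fun z => F (ν, z) + F' (ν, z)) x
      = ∑ ν, covDstar T V ν (fun z => F (ν, z)) x + ∑ ν, covDstar T V ν (fun z => F' (ν, z)) x := by
  rw [← Finset.sum_add_distrib]
  refine Finset.sum_congr rfl fun ν _ => ?_
  exact covDstar_add T V ν (fun z => F (ν, z)) (fun z => F' (ν, z)) x

/-- … and commutes with real scalars (as complex ones, `covDstar_smul`). [folklore] [cite: Balaban1985BackgroundPropagators, (3.8) p.392] -/
private theorem sum_covDstar_smul (V : κ → S → 𝔸ˣ) (r : ℝ) (F : κ × S → 𝔸) (x : S) :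
    ∑ ν, covDstar T V ν (fun z => r • F (ν, z)) x = (r : ℂ) • ∑ ν, covDstar T V ν (fun z => F (ν, z)) x := by
  rw [Finset.smul_sum]
  refine Finset.sum_congr rfl fun ν _ => ?_
  have h : (fun z => r • F (ν, z)) = (r : ℂ) • fun z => F (ν, z) := by
    funext z; exact (Complex.coe_smul r (F (ν, z))).symm
  rw [h, covDstar_smul]

/-- **`D*_V` AS A TWO-SPACE LETTER** (bonds → sites), true units: `(divLin c V F)(x) = c·Σ_ν(D¹*_{V,ν}F_ν)(x)` (pv27's `divB`; (3.8); for
`V = U′U` it is `D*_{U′U}` of (3.74)/(3.76)). [cite: Balaban1985BackgroundPropagators, (3.8) p.392 + (3.76) p.405] -/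
def divLin (c : ℂ) (V : κ → S → 𝔸ˣ) : (κ × S → 𝔸) →ₗ[ℝ] (S → 𝔸) where
  toFun F := fun x => c • ∑ ν, covDstar T V ν (fun z => F (ν, z)) x
  map_add' F F' := by
    funext x
    simp only [Pi.add_apply]
    rw [sum_covDstar_add, smul_add]
  map_smul' r F := by
    funext x
    simp only [RingHom.id_apply, Pi.smul_apply]
    rw [sum_covDstar_smul, smul_comm, Complex.coe_smul]

/-- Unfolding `divLin`. [cite: Balaban1985BackgroundPropagators, (3.8) p.392] -/
theorem divLin_apply (c : ℂ) (V : κ → S → 𝔸ˣ) (F : κ × S → 𝔸) (x : S) :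
    divLin T c V F x = c • ∑ ν, covDstar T V ν (fun z => F (ν, z)) x := rfl

/-- **`D_V ∘ D*_V = (DD*)_V`**: the composite of the two letters is `B9Eq372RemLetters.gradDivLetter T c V` (pv27's `gradDiv`, true units `c²`) —
so that (3.75) `gradDivLetter_prodCfg` / `conj_gradDivLetter_prodCfg` apply to the words of (3.76). [cite: Balaban1985BackgroundPropagators, (3.75)–(3.76) p.405] -/
theorem gradLin_comp_divLin (c : ℂ) (V : κ → S → 𝔸ˣ) :
    gradLin T c V ∘ₗ divLin T c V = gradDivLetter T c V := by
  apply LinearMap.ext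
  intro F
  funext p
  rw [LinearMap.comp_apply, gradLin_apply, gradDivLetter_apply, gradDiv]
  have h : (divLin T c V F) = c • fun x => ∑ ν, covDstar T V ν (fun z => F (ν, z)) x := rfl
  rw [h, covD_smul, smul_smul, ← pow_two, covD_sum]

end Letters

/-! ## §4  The sizes of `D_{U′U} − D_U` and `D*_{U′U} − D*_U` («O(|A|)», (3.70)/(3.74) with (3.37)) -/

section Sizes

variable {𝔸 : Type*} [NormedRing 𝔸] [NormedAlgebra ℂ 𝔸] [CompleteSpace 𝔸] {S : Type} {κ : Type}
variable (T : κ → Equiv.Perm S) (U : κ → S → 𝔸ˣ)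

omit [CompleteSpace 𝔸] in
/-- `e^{2s} − 1 ≦ 4s` for `0 ≦ s ≦ 1/2` (`Real.abs_exp_sub_one_le`). [folklore] [cite: Balaban1985BackgroundPropagators, (3.70) p.404] -/
theorem exp_two_mul_sub_one_le_four_mul {s : ℝ} (hs : 0 ≤ s) (hs' : s ≤ 1 / 2) : Real.exp (2 * s) - 1 ≤ 4 * s := by
  have h2s : |2 * s| = 2 * s := abs_of_nonneg (by linarith)
  have h := Real.abs_exp_sub_one_le (x := 2 * s) (by rw [h2s]; linarith)
  rw [h2s] at h
  linarith [le_abs_self (Real.exp (2 * s) - 1)]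

/-- **POINTWISE SIZE OF `D_{U′U} − D_U`** (group-valued background, `η > 0`, `η‖A_μ(x)‖ ≦ 1/2`): `‖c·((D¹_{U′U,μ} − D¹_{U,μ})f)(x)‖ ≦
‖c‖·4η‖A_μ(x)‖·‖f(x+e_μ)‖` — pv27's exact (3.70) `norm_covD_prodCfg_sub_le` (`(e^{2η‖A‖} − 1)‖R(U)f(x+e_μ)‖`), `‖R(U)Y‖ ≦ ‖Y‖`, `e^{2s} − 1 ≦ 4s`.
[cite: Balaban1985BackgroundPropagators, (3.70) p.404 + (3.76) p.405] -/
theorem norm_gradLin_sub_apply_le {η : ℝ} (hη : 0 ≤ η) (hU1 : ∀ μ x, ‖((U μ x : 𝔸ˣ) : 𝔸)‖ ≤ 1 ∧ ‖(((U μ x)⁻¹ : 𝔸ˣ) : 𝔸)‖ ≤ 1)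
    (A : κ → S → 𝔸) (c : ℂ) (f : S → 𝔸) (p : κ × S) (hsm : η * ‖A p.1 p.2‖ ≤ 1 / 2) :
    ‖(gradLin T c (prodCfg U η A) - gradLin T c U) f p‖ ≤ ‖c‖ * (4 * (η * ‖A p.1 p.2‖)) * ‖f (T p.1 p.2)‖ := by
  rw [LinearMap.sub_apply, Pi.sub_apply, gradLin_apply, gradLin_apply, ← smul_sub, norm_smul, mul_assoc]
  refine mul_le_mul_of_nonneg_left ?_ (norm_nonneg _)
  refine (norm_covD_prodCfg_sub_le T U hη A p.1 f p.2).trans ?_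
  have h1 : Real.exp (2 * (η * ‖A p.1 p.2‖)) - 1 ≤ 4 * (η * ‖A p.1 p.2‖) :=
    exp_two_mul_sub_one_le_four_mul (mul_nonneg hη (norm_nonneg _)) hsm
  have h2 : ‖R (U p.1 p.2) (f (T p.1 p.2))‖ ≤ ‖f (T p.1 p.2)‖ := by
    have := B9Eq369Small.norm_R_le_rho (hU1 p.1 p.2).1 (hU1 p.1 p.2).2 (f (T p.1 p.2))
    simpa using this
  have h0 : 0 ≤ Real.exp (2 * (η * ‖A p.1 p.2‖)) - 1 := by
    rw [sub_nonneg]; exact Real.one_le_exp (by positivity)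
  exact mul_le_mul h1 h2 (norm_nonneg _) (by positivity)

variable {ι : Type} [Fintype ι] (b : Module.Basis ι ℝ 𝔸)
variable {g : B9.Geometry} [Fintype g.Site] {Rr : ℝ} {H : Prop}

/-- **THE LETTER `E = D_{U′U} − D_U` HAS THE MAJORANT `4α₁(Lʲη)⁻¹·M·e^{δd₀}·e^{−δd(y,y′)}`** (two-space, sites → bonds, bond `(μ,x)` in the block
of `x`), `M = M₂Σ_i‖b_i‖`: from §4's pointwise size with (3.37) `‖A_μ(x)‖ ≦ α₁(L^{j}η)⁻¹` (`j` the scale of the block of `x`), `η·α₁(Lʲη)⁻¹ ≦ 1/4`,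
true units `c = η⁻¹`, `η > 0`, and the forward-neighbour geometry `d(y(x), y(x+e_μ)) ≦ d₀` — the `hE` input of `B9Ineq377POne.ineq377_op` with
`c_E = 4M e^{δd₀}`. [cite: Balaban1985BackgroundPropagators, (3.70) p.404 + (3.76)–(3.77) pp.405–406 + (3.37) p.396; Balaban1984PropagatorsII, (2.51) p.232] -/
theorem hasMajorantHom_gradLin_sub (blk : S → g.Site) {η : ℝ} (hη : 0 < η)
    (hU1 : ∀ μ x, ‖((U μ x : 𝔸ˣ) : 𝔸)‖ ≤ 1 ∧ ‖(((U μ x)⁻¹ : 𝔸ˣ) : 𝔸)‖ ≤ 1) (A : κ → S → 𝔸) (d₀ δ M₂ α₁ : ℝ)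
    (hα₁ : 0 ≤ α₁) (hδ : 0 ≤ δ) (hM₂ : 0 ≤ M₂) (hrepr : ∀ (w : 𝔸) (i : ι), |b.repr w i| ≤ M₂ * ‖w‖)
    (hlen : ∀ y : g.Site, 0 < g.len y) (hA : ∀ k x, ‖A k x‖ ≤ α₁ * (g.len (blk x))⁻¹)
    (hsmall : ∀ y : g.Site, η * (α₁ * (g.len y)⁻¹) ≤ 1 / 4) (hd₀F : ∀ μ x, g.dist (blk x) (blk (T μ x)) ≤ d₀) :
    HasMajorantHom (g := toB6 g Rr H) (fun p : S × ι => blk p.1) (fun q : (κ × S) × ι => blk q.1.2)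
      (conjHom b (gradLin T ((η : ℂ)⁻¹) (prodCfg U η A) - gradLin T ((η : ℂ)⁻¹) U))
      (fun a a' => 4 * (M₂ * ∑ i, ‖b i‖) * Real.exp (δ * d₀) * α₁ * (g.len a)⁻¹ * Real.exp (-(δ * g.dist a a'))) := by
  have hc : ∀ a : g.Site, 0 ≤ 4 * (α₁ * (g.len a)⁻¹) := fun a =>
    mul_nonneg (by norm_num) (mul_nonneg hα₁ (inv_nonneg.mpr (hlen a).le))
  have h := hasMajorantHom_conj_of_local (Rr := Rr) (H := H) b blk (fun q : κ × S => blk q.2) (fun q x' => x' = T q.1 q.2)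
    (fun a => 4 * (α₁ * (g.len a)⁻¹)) d₀ δ M₂ hc hδ hM₂ hrepr (fun q x' hx' => by rw [hx']; exact hd₀F q.1 q.2)
    (gradLin T ((η : ℂ)⁻¹) (prodCfg U η A) - gradLin T ((η : ℂ)⁻¹) U) ?_
  · refine hasMajorantHom_mono _ _ h fun a a' => le_of_eq (by ring)
  intro f q B hB
  have hsm : η * ‖A q.1 q.2‖ ≤ 1 / 2 :=
    (mul_le_mul_of_nonneg_left (hA q.1 q.2) hη.le).trans ((hsmall _).trans (by norm_num))
  refine (norm_gradLin_sub_apply_le T U hη.le hU1 A _ f q hsm).trans ?_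
  have hcη : ‖((η : ℂ)⁻¹)‖ = η⁻¹ := by rw [norm_inv, Complex.norm_real, Real.norm_eq_abs, abs_of_pos hη]
  rw [hcη]
  have hfB : ‖f (T q.1 q.2)‖ ≤ B := hB _ rfl
  have hB0 : 0 ≤ B := (norm_nonneg _).trans hfB
  calc η⁻¹ * (4 * (η * ‖A q.1 q.2‖)) * ‖f (T q.1 q.2)‖ = 4 * ‖A q.1 q.2‖ * ‖f (T q.1 q.2)‖ := by
        field_simp
    _ ≤ 4 * (α₁ * (g.len (blk q.2))⁻¹) * B :=
        mul_le_mul (mul_le_mul_of_nonneg_left (hA q.1 q.2) (by norm_num)) hfB (norm_nonneg _) (hc _)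

variable [Fintype κ]

/-- **POINTWISE SIZE OF `D*_{U′U} − D*_U`** (group-valued background, `η > 0`, `η‖(τ*_νA_ν)(x)‖ ≦ 1/2` for all `ν`):
`‖c·((D¹*_{U′U} − D¹*_U)F)(x)‖ ≦ ‖c‖·Σ_ν 4η‖(τ*_νA_ν)(x)‖·‖F_ν(x−e_ν)‖`, `(τ*_νA_ν)(x) = R(U(x,x−e_ν))A_ν(x−e_ν)` (`B9Eq352DivForm.tauB`) — pv27's
exact (3.74) `norm_covDstar_prodCfg_sub_le`. [cite: Balaban1985BackgroundPropagators, (3.74) p.405 + (3.76) p.405] -/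
theorem norm_divLin_sub_apply_le {η : ℝ} (hη : 0 ≤ η) (hU1 : ∀ μ x, ‖((U μ x : 𝔸ˣ) : 𝔸)‖ ≤ 1 ∧ ‖(((U μ x)⁻¹ : 𝔸ˣ) : 𝔸)‖ ≤ 1)
    (A : κ → S → 𝔸) (c : ℂ) (F : κ × S → 𝔸) (x : S) (hsm : ∀ ν, η * ‖tauB T U ν (A ν) x‖ ≤ 1 / 2) :
    ‖(divLin T c (prodCfg U η A) - divLin T c U) F x‖
      ≤ ‖c‖ * ∑ ν, (4 * (η * ‖tauB T U ν (A ν) x‖)) * ‖F (ν, (T ν).symm x)‖ := by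
  rw [LinearMap.sub_apply, Pi.sub_apply, divLin_apply, divLin_apply, ← smul_sub, norm_smul, ← Finset.sum_sub_distrib]
  refine mul_le_mul_of_nonneg_left ((norm_sum_le _ _).trans (Finset.sum_le_sum fun ν _ => ?_)) (norm_nonneg _)
  refine (norm_covDstar_prodCfg_sub_le T U hη A ν (fun z => F (ν, z)) x).trans ?_
  have eτ : R (U ν ((T ν).symm x))⁻¹ (A ν ((T ν).symm x)) = tauB T U ν (A ν) x := (tauB_apply T U ν (A ν) x).symm
  rw [eτ]
  have h1 : Real.exp (2 * (η * ‖tauB T U ν (A ν) x‖)) - 1 ≤ 4 * (η * ‖tauB T U ν (A ν) x‖) :=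
    exp_two_mul_sub_one_le_four_mul (mul_nonneg hη (norm_nonneg _)) (hsm ν)
  have h2 : ‖R (U ν ((T ν).symm x))⁻¹ (F (ν, (T ν).symm x))‖ ≤ ‖F (ν, (T ν).symm x)‖ := by
    have := B9Eq369Small.norm_R_inv_le_rho (hU1 ν ((T ν).symm x)).1 (hU1 ν ((T ν).symm x)).2 (F (ν, (T ν).symm x))
    simpa using this
  have h0 : 0 ≤ Real.exp (2 * (η * ‖tauB T U ν (A ν) x‖)) - 1 := by
    rw [sub_nonneg]; exact Real.one_le_exp (by positivity)
  exact mul_le_mul h1 h2 (norm_nonneg _) (by positivity)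

/-- **THE LETTER `E* = D*_{U′U} − D*_U` HAS THE MAJORANT `4·card κ·α₁(Lʲη)⁻¹·M·e^{δd₀}·e^{−δd(y,y′)}`** (two-space, bonds → sites): from §4 with (3.37)
in the transported form `‖(τ*_νA_ν)(x)‖ ≦ α₁(Lʲη)⁻¹` (`j` the scale of the block of `x`; the `hAτB` hypothesis shape of files 5–8), `η·α₁(Lʲη)⁻¹ ≦ 1/4`,
and the backward-neighbour geometry `d(y(x), y(x−e_ν)) ≦ d₀` — the `hEs` input of `B9Ineq377POne.ineq377_op` with `c_E = 4·card κ·M e^{δd₀}`.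
[cite: Balaban1985BackgroundPropagators, (3.74) p.405 + (3.76)–(3.77) pp.405–406 + (3.37) p.396; Balaban1984PropagatorsII, (2.51) p.232] -/
theorem hasMajorantHom_divLin_sub (blk : S → g.Site) {η : ℝ} (hη : 0 < η)
    (hU1 : ∀ μ x, ‖((U μ x : 𝔸ˣ) : 𝔸)‖ ≤ 1 ∧ ‖(((U μ x)⁻¹ : 𝔸ˣ) : 𝔸)‖ ≤ 1) (A : κ → S → 𝔸) (d₀ δ M₂ α₁ : ℝ)
    (hα₁ : 0 ≤ α₁) (hδ : 0 ≤ δ) (hM₂ : 0 ≤ M₂) (hrepr : ∀ (w : 𝔸) (i : ι), |b.repr w i| ≤ M₂ * ‖w‖)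
    (hlen : ∀ y : g.Site, 0 < g.len y) (hAτB : ∀ ν x, ‖tauB T U ν (A ν) x‖ ≤ α₁ * (g.len (blk x))⁻¹)
    (hsmall : ∀ y : g.Site, η * (α₁ * (g.len y)⁻¹) ≤ 1 / 4) (hd₀B : ∀ ν x, g.dist (blk x) (blk ((T ν).symm x)) ≤ d₀) :
    HasMajorantHom (g := toB6 g Rr H) (fun q : (κ × S) × ι => blk q.1.2) (fun p : S × ι => blk p.1)
      (conjHom b (divLin T ((η : ℂ)⁻¹) (prodCfg U η A) - divLin T ((η : ℂ)⁻¹) U))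
      (fun a a' => 4 * Fintype.card κ * (M₂ * ∑ i, ‖b i‖) * Real.exp (δ * d₀) * α₁ * (g.len a)⁻¹
        * Real.exp (-(δ * g.dist a a'))) := by
  have hc : ∀ a : g.Site, 0 ≤ 4 * Fintype.card κ * (α₁ * (g.len a)⁻¹) := fun a =>
    mul_nonneg (mul_nonneg (by norm_num) (Nat.cast_nonneg _)) (mul_nonneg hα₁ (inv_nonneg.mpr (hlen a).le))
  have h := hasMajorantHom_conj_of_local (Rr := Rr) (H := H) b (fun q : κ × S => blk q.2) blk
    (fun x q => q.2 = (T q.1).symm x) (fun a => 4 * Fintype.card κ * (α₁ * (g.len a)⁻¹)) d₀ δ M₂ hc hδ hM₂ hrepr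
    (fun x q hq => by rw [hq]; exact hd₀B q.1 x)
    (divLin T ((η : ℂ)⁻¹) (prodCfg U η A) - divLin T ((η : ℂ)⁻¹) U) ?_
  · refine hasMajorantHom_mono _ _ h fun a a' => le_of_eq (by ring)
  intro F x B hB
  have hsm : ∀ ν, η * ‖tauB T U ν (A ν) x‖ ≤ 1 / 2 := fun ν =>
    (mul_le_mul_of_nonneg_left (hAτB ν x) hη.le).trans ((hsmall _).trans (by norm_num))
  refine (norm_divLin_sub_apply_le T U hη.le hU1 A _ F x hsm).trans ?_
  have hcη : ‖((η : ℂ)⁻¹)‖ = η⁻¹ := by rw [norm_inv, Complex.norm_real, Real.norm_eq_abs, abs_of_pos hη]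
  rw [hcη]
  have hFB : ∀ ν, ‖F (ν, (T ν).symm x)‖ ≤ B := fun ν => hB (ν, (T ν).symm x) rfl
  have hterm : ∀ ν, (4 * (η * ‖tauB T U ν (A ν) x‖)) * ‖F (ν, (T ν).symm x)‖ ≤ 4 * (η * (α₁ * (g.len (blk x))⁻¹)) * B :=
    fun ν => mul_le_mul (mul_le_mul_of_nonneg_left (mul_le_mul_of_nonneg_left (hAτB ν x) hη.le) (by norm_num)) (hFB ν)
      (norm_nonneg _) (by have := hlen (blk x); positivity)
  calc η⁻¹ * ∑ ν, (4 * (η * ‖tauB T U ν (A ν) x‖)) * ‖F (ν, (T ν).symm x)‖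
      ≤ η⁻¹ * ∑ _ν : κ, 4 * (η * (α₁ * (g.len (blk x))⁻¹)) * B :=
        mul_le_mul_of_nonneg_left (Finset.sum_le_sum fun ν _ => hterm ν) (inv_nonneg.mpr hη.le)
    _ = 4 * Fintype.card κ * (α₁ * (g.len (blk x))⁻¹) * B := by
        rw [Finset.sum_const, Finset.card_univ, nsmul_eq_mul]
        field_simp

end Sizes

/-! ## §5  (3.76) on the bond carrier with `P₁(A)` concrete -/

section Eq376

variable {𝔸 : Type*} [NormedRing 𝔸] [NormedAlgebra ℂ 𝔸] {S : Type} {κ : Type} [Fintype κ]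
variable (T : κ → Equiv.Perm S) (U : κ → S → 𝔸ˣ)
variable {ι : Type} [Fintype ι] (b : Module.Basis ι ℝ 𝔸)

/-- `conjHom b (D_V) ∘ conjHom b (D*_V) = conj b ((DD*)_V)` in real coordinates (functoriality + `gradLin_comp_divLin`).
[cite: Balaban1985BackgroundPropagators, (3.75)–(3.76) p.405; Balaban1984PropagatorsII, (2.52) p.232] -/
theorem conjHom_gradLin_comp_divLin (c : ℂ) (V : κ → S → 𝔸ˣ) :
    conjHom b (gradLin T c V) ∘ₗ conjHom b (divLin T c V) = conj b (gradDivLetter T c V) := by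
  rw [conjHom_comp, gradLin_comp_divLin, conjHom_eq_conj]

variable [CompleteSpace 𝔸] [DecidableEq κ]

/-- **(3.75) IN REAL COORDINATES FOR THE TWO-SPACE LETTERS**: `D_{U′U} ∘ D*_{U′U} = D_U ∘ D*_U − V₂(A)` —
`conjHom b (gradLin(U′U)) ∘ conjHom b (divLin(U′U)) = conjHom b (gradLin U) ∘ conjHom b (divLin U) − conj b (V₂Op η A)`
(`B9Eq372RemLetters.conj_gradDivLetter_prodCfg` BY NAME). [cite: Balaban1985BackgroundPropagators, (3.75) p.405] -/
theorem conjHom_gradLin_prodCfg_comp_divLin_prodCfg {η : ℝ} (hη : η ≠ 0) (A : κ → S → 𝔸) :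
    conjHom b (gradLin T ((η : ℂ)⁻¹) (prodCfg U η A)) ∘ₗ conjHom b (divLin T ((η : ℂ)⁻¹) (prodCfg U η A))
      = conjHom b (gradLin T ((η : ℂ)⁻¹) U) ∘ₗ conjHom b (divLin T ((η : ℂ)⁻¹) U) - conj b (V₂Op T U η A) := by
  rw [conjHom_gradLin_comp_divLin, conjHom_gradLin_comp_divLin, conj_gradDivLetter_prodCfg T U b hη]

/-- **(3.76) ON THE BOND CARRIER, `P₁(A)` CONCRETE**: for ANY letters `P` («P(U) = I − R(U)») and `P′` («F(A)»: (3.68) `P(U′U) = P(U) + F(A)`) of the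
site carrier, with `Dc = conjHom b (η⁻¹D¹_U)`, `Dc′ = conjHom b (η⁻¹D¹_{U′U})`, `Dsc`, `Dsc′` the divergence twins:
`Dc′∘(1 − (P + P′))∘Dsc′ = Dc∘(1 − P)∘Dsc − conj b (V₂Op η A) − P₁`,
`P₁ = (Dc′ − Dc)∘P∘Dsc + Dc∘P∘(Dsc′ − Dsc) + (Dc′ − Dc)∘P∘(Dsc′ − Dsc) + Dc′∘P′∘Dsc′` — the print's display (3.76) with (3.75) inserted
(`B9Eq386Neumann.eq376` is the same algebra in ONE ring; here the letters are typed between the two carriers); this is the `h376` hypothesis of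
`B9Ineq386V3Concrete.thm34_G_entries13_concreteV₃` with `P₁` concrete. [cite: Balaban1985BackgroundPropagators, (3.76) p.405 + (3.68) p.403 + (3.75) p.405] -/
theorem eq376_concrete {η : ℝ} (hη : η ≠ 0) (A : κ → S → 𝔸) (P Pp : Module.End ℝ (S × ι → ℝ)) :
    conjHom b (gradLin T ((η : ℂ)⁻¹) (prodCfg U η A)) ∘ₗ (1 - (P + Pp)) ∘ₗ conjHom b (divLin T ((η : ℂ)⁻¹) (prodCfg U η A))
      = conjHom b (gradLin T ((η : ℂ)⁻¹) U) ∘ₗ (1 - P) ∘ₗ conjHom b (divLin T ((η : ℂ)⁻¹) U) - conj b (V₂Op T U η A)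
        - ((conjHom b (gradLin T ((η : ℂ)⁻¹) (prodCfg U η A)) - conjHom b (gradLin T ((η : ℂ)⁻¹) U)) ∘ₗ P
              ∘ₗ conjHom b (divLin T ((η : ℂ)⁻¹) U)
            + conjHom b (gradLin T ((η : ℂ)⁻¹) U) ∘ₗ P
              ∘ₗ (conjHom b (divLin T ((η : ℂ)⁻¹) (prodCfg U η A)) - conjHom b (divLin T ((η : ℂ)⁻¹) U))
            + (conjHom b (gradLin T ((η : ℂ)⁻¹) (prodCfg U η A)) - conjHom b (gradLin T ((η : ℂ)⁻¹) U)) ∘ₗ P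
              ∘ₗ (conjHom b (divLin T ((η : ℂ)⁻¹) (prodCfg U η A)) - conjHom b (divLin T ((η : ℂ)⁻¹) U))
            + conjHom b (gradLin T ((η : ℂ)⁻¹) (prodCfg U η A)) ∘ₗ Pp ∘ₗ conjHom b (divLin T ((η : ℂ)⁻¹) (prodCfg U η A))) := by
  have h375 := conjHom_gradLin_prodCfg_comp_divLin_prodCfg T U b hη A
  -- abbreviate the four letters
  set D' := conjHom b (gradLin T ((η : ℂ)⁻¹) (prodCfg U η A)) with hD'
  set D := conjHom b (gradLin T ((η : ℂ)⁻¹) U) with hD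
  set Ds' := conjHom b (divLin T ((η : ℂ)⁻¹) (prodCfg U η A)) with hDs'
  set Ds := conjHom b (divLin T ((η : ℂ)⁻¹) U) with hDs
  set V₂ := conj b (V₂Op T U η A) with hV₂
  have e1 : D' ∘ₗ (1 - (P + Pp)) ∘ₗ Ds' = D' ∘ₗ Ds' - D' ∘ₗ P ∘ₗ Ds' - D' ∘ₗ Pp ∘ₗ Ds' := by
    simp only [LinearMap.sub_comp, LinearMap.add_comp, LinearMap.comp_sub, LinearMap.comp_add, Module.End.one_eq_id,
      LinearMap.id_comp]
    abel
  have e2 : D ∘ₗ (1 - P) ∘ₗ Ds = D ∘ₗ Ds - D ∘ₗ P ∘ₗ Ds := by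
    simp only [LinearMap.sub_comp, LinearMap.comp_sub, Module.End.one_eq_id, LinearMap.id_comp]
  rw [e1, e2, h375]
  simp only [LinearMap.sub_comp, LinearMap.comp_sub]
  abel

end Eq376

end Literature.MathematicalPhysics.QuantumFieldTheory.Balaban1983to89.B9Eq376POneLetters

end
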